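import Summits.AtomisticToContinuum.BoseEinsteinCondensation.Theorems.BECTangentRigidityRigidMomentumBoundStubDirichletEnergyLinear
import Summits.AtomisticToContinuum.BoseEinsteinCondensation.Theorems.BECTangentRigidityRigidMomentumBoundStubEnergyScalePotentialLe
import Summits.AtomisticToContinuum.BoseEinsteinCondensation.Theorems.BECTangentRigidityRigidMomentumBoundStubDisplacementSoftnessOfContactSoftness
import Summits.AtomisticToContinuum.BoseEinsteinCondensation.Theorems.BECTangentRigidityRigidMomentumBoundStubRigidMomentumBoundOfDisplacementSoftnessAt
import Summits.AtomisticToContinuum.BoseEinsteinCondensation.Theorems.BECTangentRigidityRigidMomentumBoundStubPairCounting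
import Summits.AtomisticToContinuum.BoseEinsteinCondensation.Theorems.BECTangentRigidityRigidMomentumBoundSoftCoreExpectation
import HarnessLib

/-!
# Crux `RigidMomentumBound` (stmt-AtomisticToContinuum-13034), line `registered`:
# the crux's conclusion for soft-core Lipschitz potentials

Supports (does not close) stmt-AtomisticToContinuum-13034 (the crux quantifies over ALL repulsive
finite-range potentials, hard cores included; here we settle its conclusion for the sub-class of
potentials `v = ofReal ∘ f` with `f` Lipschitz, `f = 0` on `[R, ∞)` and `f ≥ c > 0` on `[0, r₀)` — every
smooth repulsive finite-range potential with `v(0) > 0`).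

**Theorem `rigidMomentumBound_softCore`.** For such `v`, at all small densities, for every `ε > 0`,
eventually in `N` there is `δ > 0` such that every `δ`-near-minimiser `Ψ` of the Dirichlet energy in the
box of side `L_N = (N/ρ)^{1/3}` has total-momentum fluctuation `∑ₐ∫|∑ⱼ∂_{j,a}Ψ|² ≤ εN²/L_N²`.

**Proof** (all inputs landed under `…Theorems/BECTangentRigidityRigidMomentumBound*.lean`):
1. `stub_rigidMomentumBound_of_displacementSoftness_at` (König identity + rigid smearing): it suffices
   to prove displacement softness of `E₀(v; N, ·)` at scale `L/N` for this `v`.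
2. `stub_displacementSoftness_of_contactSoftness` (exact dilation covariance): it suffices to prove
   CONTACT softness: `E₀(v_s; N, sL_N) ≤ E₀(v; N, sL_N) + εN/L_N²`, `s = 1 + κ/N`, `v_s = s⁻²v(·/s)`.
3. `stub_energyScalePotentialLe`: for a near-minimiser `Φ` of `v` in the box `sL_N`,
   `⟨Φ,H_{v_s}Φ⟩ ≤ ⟨Φ,H_vΦ⟩ + K s R (1 - s⁻¹) · 𝔼_Φ #{pairs within sR}` (Lipschitz bound).
4. `stub_pairCounting` + `SoftCore.lintegral_card_pairs_le` + `SoftCore.ofReal_mul_lintegral_card_le_energy`: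
   `𝔼_Φ #{pairs within 2R} ≤ 3M N^{1/4}(N + 𝔼_Φ #{pairs closer than r₀}) ≤ 3M N^{1/4}(N + ⟨Φ,H_vΦ⟩/c)`
   (cells + double counting + Cauchy–Schwarz, linear in the number of close pairs, which the soft core
   controls by the energy), and `⟨Φ,H_vΦ⟩ ≤ E₀ + δ ≤ CN + δ` (`stub_dirichletEnergyLinear`).
5. Hence the fattening cost is `O(κ N⁻¹ · N^{1/4} · N) = O(N^{1/4}) ≪ εN/L_N² ≍ N^{1/3}`.

Hard cores (`v = ⊤·1_{[0,a)}`) escape step 3 (no Lipschitz bound; the fattened core overlaps pairs at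
distance in `[a, sa)`), which is exactly the residual open stub `stub_displacementSoftness`.
-/

noncomputable section

open MeasureTheory Filter
open scoped ENNReal NNReal BigOperators

namespace Summit.AtomisticToContinuum.BoseEinsteinCondensation.Theorems.RigidMomentumBound

open Literature.MathematicalPhysics.QuantumManyBody.BoseGas

namespace SoftCore

/-- A potential `ofReal ∘ f` with `f` Lipschitz and vanishing on `[R, ∞)` is an admissible repulsive
finite-range interaction. [folklore] -/
theorem isRepulsiveFiniteRange_ofReal {f : ℝ → ℝ} {K R : ℝ}
    (hlip : ∀ r r' : ℝ, |f r - f r'| ≤ K * |r - r'|) (hzero : ∀ r : ℝ, R ≤ r → f r = 0) :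
    IsRepulsiveFiniteRange fun r => ENNReal.ofReal (f r) := by
  refine ⟨ENNReal.measurable_ofReal.comp ?_, R, fun r hr => by simp [hzero r hr.le]⟩
  have hK : LipschitzWith (Real.toNNReal K) f := by
    refine LipschitzWith.of_dist_le_mul fun r r' => ?_
    rw [Real.dist_eq, Real.dist_eq]
    refine (hlip r r').trans (mul_le_mul_of_nonneg_right ?_ (abs_nonneg _))
    exact Real.le_coe_toNNReal K
  exact hK.continuous.measurable

/-- `√√(x⁴) = x` for `x ≥ 0`. [folklore] -/
theorem sqrt_sqrt_pow_four' {x : ℝ} (hx : 0 ≤ x) : Real.sqrt (Real.sqrt (x ^ 4)) = x := by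
  rw [show x ^ 4 = (x ^ 2) ^ 2 by ring, Real.sqrt_sq (sq_nonneg x), Real.sqrt_sq hx]

/-- **The real-analysis heart of the eventual estimate**: with `m = L^{1/4}`, `N = ρL³` gives
`N^{1/4} = ρ^{1/4} m³`, so `Z₀ N^{1/4} ≤ (ε/2) ρ L` as soon as `L ≥ (2Z₀ρ^{1/4}/(ερ))⁴`. [folklore] -/
theorem quarter_power_le {Z₀ ε ρ L : ℝ} (hZ : 0 ≤ Z₀) (hε : 0 < ε) (hρ : 0 < ρ) (hL : 0 ≤ L)
    (hm : (2 * Z₀ * Real.sqrt (Real.sqrt ρ) / (ε * ρ)) ^ 4 ≤ L) :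
    Z₀ * Real.sqrt (Real.sqrt (ρ * L ^ 3)) ≤ ε / 2 * (ρ * L) := by
  set m := Real.sqrt (Real.sqrt L) with hmdef
  set q := Real.sqrt (Real.sqrt ρ) with hqdef
  have hm0 : 0 ≤ m := Real.sqrt_nonneg _
  have hq0 : 0 ≤ q := Real.sqrt_nonneg _
  have hm4 : m ^ 4 = L := by
    have h2 : m ^ 2 = Real.sqrt L := Real.sq_sqrt (Real.sqrt_nonneg L)
    calc m ^ 4 = (m ^ 2) ^ 2 := by ring
      _ = L := by rw [h2, Real.sq_sqrt hL]
  have hq4 : q ^ 4 = ρ := by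
    have h2 : q ^ 2 = Real.sqrt ρ := Real.sq_sqrt (Real.sqrt_nonneg ρ)
    calc q ^ 4 = (q ^ 2) ^ 2 := by ring
      _ = ρ := by rw [h2, Real.sq_sqrt hρ.le]
  -- `√√(ρ L³) = q m³`
  have hN4 : Real.sqrt (Real.sqrt (ρ * L ^ 3)) = q * m ^ 3 := by
    have : ρ * L ^ 3 = (q * m ^ 3) ^ 4 := by
      rw [← hq4, ← hm4]; ring
    rw [this, sqrt_sqrt_pow_four' (by positivity)]
  -- `m ≥ m₀ := 2 Z₀ q/(ε ρ)`
  set m₀ := 2 * Z₀ * q / (ε * ρ) with hm₀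
  have hm₀0 : 0 ≤ m₀ := by positivity
  have hmm : m₀ ≤ m := by
    have h1 : Real.sqrt (Real.sqrt (m₀ ^ 4)) ≤ Real.sqrt (Real.sqrt L) :=
      Real.sqrt_le_sqrt (Real.sqrt_le_sqrt hm)
    rwa [sqrt_sqrt_pow_four' hm₀0] at h1
  rw [hN4, ← hm4]
  have key : Z₀ * q ≤ ε / 2 * ρ * m := by
    have e : ε / 2 * ρ * m₀ = Z₀ * q := by rw [hm₀]; field_simp
    have := mul_le_mul_of_nonneg_left hmm (by positivity : (0 : ℝ) ≤ ε / 2 * ρ)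
    linarith
  have hm3 : 0 ≤ m ^ 3 := by positivity
  have := mul_le_mul_of_nonneg_right key hm3
  nlinarith [this]

/-- **Contact softness for soft-core Lipschitz potentials.** With `v = ofReal ∘ f` (`f` `K`-Lipschitz,
`f = 0` on `[R,∞)`, `f ≥ c > 0` on `[0,r₀)`, `r₀ ≤ 2R`) and a linear energy bound `E₀(v;N,L_N) ≤ CN`
below the density `ρ₁`: for `ρ < ρ₁`, `ε, κ > 0`, eventually in `N`,
`E₀(v_s; N, sL_N) ≤ E₀(v; N, sL_N) + εN/L_N²`, `s = 1 + κ/N`. [folklore] -/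
theorem contactSoftness_softCore {f : ℝ → ℝ} {K R c r₀ : ℝ} (hK : 0 ≤ K) (hR : 0 < R) (hc : 0 < c)
    (hr₀ : 0 < r₀) (hr₀R : r₀ ≤ 2 * R)
    (hlip : ∀ r r' : ℝ, |f r - f r'| ≤ K * |r - r'|) (hzero : ∀ r : ℝ, R ≤ r → f r = 0)
    (hcore : ∀ r : ℝ, 0 ≤ r → r < r₀ → c ≤ f r) {ρ₁ : ℝ} (hρ₁ : 0 < ρ₁)
    (hlin : ∀ ρ : ℝ, 0 < ρ → ρ < ρ₁ → ∃ C : ℝ, 0 ≤ C ∧ ∀ᶠ N : ℕ in atTop,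
      groundStateEnergy (fun r => ENNReal.ofReal (f r)) N (sideLength ρ N) ≤ ENNReal.ofReal (C * N)) :
    ∃ ρ₂ : ℝ, 0 < ρ₂ ∧ ∀ ρ : ℝ, 0 < ρ → ρ < ρ₂ → ∀ ε : ℝ, 0 < ε → ∀ κ : ℝ, 0 < κ →
      ∀ᶠ N : ℕ in atTop,
        groundStateEnergy (scalePotential (1 + κ / N) (fun r => ENNReal.ofReal (f r))) N
            ((1 + κ / N) * sideLength ρ N) ≤
          groundStateEnergy (fun r => ENNReal.ofReal (f r)) N ((1 + κ / N) * sideLength ρ N) +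
            ENNReal.ofReal (ε * N / sideLength ρ N ^ 2) := by
  set v : ℝ → ℝ≥0∞ := fun r => ENNReal.ofReal (f r) with hv
  refine ⟨ρ₁, hρ₁, fun ρ hρ hρlt ε hε κ hκ => ?_⟩
  obtain ⟨C, hC0, hE⟩ := hlin ρ hρ hρlt
  set M : ℝ := (8 * R / r₀ + 2) ^ 3 with hM
  have hM0 : 0 ≤ M := by positivity
  -- the constant in front of `N^{1/4}`
  set Z₀ : ℝ := 2 * K * R * κ * (3 * M) * (1 + (C + ε) / c) with hZ₀
  have hZ₀0 : 0 ≤ Z₀ := by positivity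
  have hκN : ∀ᶠ N : ℕ in atTop, κ ≤ (N : ℝ) := tendsto_natCast_atTop_atTop.eventually_ge_atTop κ
  have hLlarge : ∀ᶠ N : ℕ in atTop,
      max 1 ((2 * Z₀ * Real.sqrt (Real.sqrt ρ) / (ε * ρ)) ^ 4) ≤ sideLength ρ N :=
    (tendsto_sideLength_atTop hρ).eventually_ge_atTop _
  filter_upwards [hE, hκN, hLlarge, eventually_ge_atTop 1] with N hEN hκN' hLN hN1
  have hN0 : 0 < N := hN1
  have hNpos : (0 : ℝ) < N := Nat.cast_pos.2 hN0
  set L := sideLength ρ N with hLdef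
  have hL1 : 1 ≤ L := (le_max_left _ _).trans hLN
  have hLpos : 0 < L := one_pos.trans_le hL1
  have hLm : (2 * Z₀ * Real.sqrt (Real.sqrt ρ) / (ε * ρ)) ^ 4 ≤ L := (le_max_right _ _).trans hLN
  set s : ℝ := 1 + κ / N with hsdef
  have hs1 : 1 ≤ s := le_add_of_nonneg_right (by positivity)
  have hspos : 0 < s := one_pos.trans_le hs1
  have hκN1 : κ / N ≤ 1 := (div_le_one hNpos).2 hκN'
  have hs2 : s ≤ 2 := by rw [hsdef]; linarith
  -- the energies involved are finite
  set E' := groundStateEnergy v N (s * L) with hE'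
  have hE'le : E' ≤ ENNReal.ofReal (C * N) :=
    (groundStateEnergy_anti v N (le_mul_of_one_le_left hLpos.le hs1)).trans hEN
  have hE'top : E' ≠ ⊤ := ne_top_of_le_ne_top ENNReal.ofReal_ne_top hE'le
  -- a near-minimiser `Φ` of `v` in the box `sL`, slack `θ₀ = εN/(2L²)`
  set θ₀ : ℝ≥0∞ := ENNReal.ofReal (ε * N / (2 * L ^ 2)) with hθ₀
  have hθ₀pos : 0 < θ₀ := ENNReal.ofReal_pos.2 (by positivity)
  have hlt : E' < E' + θ₀ := ENNReal.lt_add_right hE'top hθ₀pos.ne'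
  obtain ⟨Φ, hΦ⟩ := iInf_lt_iff.1 hlt
  have hΦle : energy v Φ ≤ E' + θ₀ := hΦ.le
  -- step 3: energy comparison under fattening
  have hEC := stub_energyScalePotentialLe f K R hK hR hlip hzero s hs1 Φ
  -- step 4a: pairs within `sR ≤ 2R`
  have hsR : s * R ≤ 2 * R := mul_le_mul_of_nonneg_right hs2 hR.le
  have hP_mono : ∀ X : Config N, (((Finset.univ.filter fun p : Fin N × Fin N =>
      p.1 < p.2 ∧ dist (X p.1) (X p.2) ≤ s * R).card : ℕ) : ℝ≥0∞) ≤
      (((Finset.univ.filter fun p : Fin N × Fin N =>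
        p.1 < p.2 ∧ dist (X p.1) (X p.2) ≤ 2 * R).card : ℕ) : ℝ≥0∞) := fun X => by
    exact_mod_cast Finset.card_le_card (fun p hp => by
      simp only [Finset.mem_filter] at hp ⊢
      exact ⟨hp.1, hp.2.1, hp.2.2.trans hsR⟩)
  -- step 4b: expected number of pairs within `2R`
  have hPC := fun X : Config N => stub_pairCounting N X r₀ R hr₀ hr₀R
  have hexp := lintegral_card_pairs_le hN1 Φ hr₀ hr₀R hPC
  -- step 4c: close pairs controlled by the energy
  have hclose := ofReal_mul_lintegral_card_le_energy Φ (f := f) hcore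
  have hc0 : ENNReal.ofReal c ≠ 0 := (ENNReal.ofReal_pos.2 hc).ne'
  have hAle : ∫⁻ X, (((Finset.univ.filter fun p : Fin N × Fin N =>
      p.1 < p.2 ∧ dist (X p.1) (X p.2) < r₀).card : ℕ) : ℝ≥0∞) * ((‖Φ.ψ X‖₊ : ℝ≥0∞)) ^ 2 ≤
      (ENNReal.ofReal c)⁻¹ * (E' + θ₀) := by
    calc _ = (ENNReal.ofReal c)⁻¹ * (ENNReal.ofReal c * ∫⁻ X, (((Finset.univ.filter
            fun p : Fin N × Fin N => p.1 < p.2 ∧ dist (X p.1) (X p.2) < r₀).card : ℕ) : ℝ≥0∞) *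
              ((‖Φ.ψ X‖₊ : ℝ≥0∞)) ^ 2) := by
          rw [← mul_assoc, ENNReal.inv_mul_cancel hc0 ENNReal.ofReal_ne_top, one_mul]
      _ ≤ (ENNReal.ofReal c)⁻¹ * energy v Φ := by gcongr
      _ ≤ (ENNReal.ofReal c)⁻¹ * (E' + θ₀) := by gcongr
  -- assemble: `E₀(v_s) ≤ energy v_s Φ ≤ E' + θ₀ + ofReal θ · ofReal T · (N + c⁻¹(E'+θ₀))`
  set θ : ℝ := K * s * R * (1 - s⁻¹) with hθ
  have h1s0 : 0 ≤ 1 - s⁻¹ := sub_nonneg.2 (inv_le_one_of_one_le₀ hs1)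
  have hθ0 : 0 ≤ θ := by positivity
  set T : ℝ := 3 * (8 * R / r₀ + 2) ^ 3 * Real.sqrt (Real.sqrt N) with hT
  have hT0 : 0 ≤ T := by positivity
  have hbig : groundStateEnergy (scalePotential s v) N (s * L) ≤
      E' + θ₀ + ENNReal.ofReal θ * (ENNReal.ofReal T *
        ((N : ℝ≥0∞) + (ENNReal.ofReal c)⁻¹ * (E' + θ₀))) := by
    calc groundStateEnergy (scalePotential s v) N (s * L) ≤ energy (scalePotential s v) Φ :=
          groundStateEnergy_le_energy _ Φ
      _ ≤ energy v Φ + ENNReal.ofReal θ * ∫⁻ X, (((Finset.univ.filter fun p : Fin N × Fin N =>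
            p.1 < p.2 ∧ dist (X p.1) (X p.2) ≤ s * R).card : ℕ) : ℝ≥0∞) * ((‖Φ.ψ X‖₊ : ℝ≥0∞)) ^ 2 :=
          hEC
      _ ≤ (E' + θ₀) + ENNReal.ofReal θ * ∫⁻ X, (((Finset.univ.filter fun p : Fin N × Fin N =>
            p.1 < p.2 ∧ dist (X p.1) (X p.2) ≤ 2 * R).card : ℕ) : ℝ≥0∞) * ((‖Φ.ψ X‖₊ : ℝ≥0∞)) ^ 2 := by
          gcongr with X
      _ ≤ (E' + θ₀) + ENNReal.ofReal θ * (ENNReal.ofReal T * ((N : ℝ≥0∞) +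
            ∫⁻ X, (((Finset.univ.filter fun p : Fin N × Fin N =>
              p.1 < p.2 ∧ dist (X p.1) (X p.2) < r₀).card : ℕ) : ℝ≥0∞) * ((‖Φ.ψ X‖₊ : ℝ≥0∞)) ^ 2)) := by
          gcongr
      _ ≤ _ := by gcongr
  -- the error term as `ofReal` of a real number `Z ≤ Z₀ N^{1/4} ≤ ε N/(2L²)`
  have hNL : (N : ℝ) / L ^ 2 = ρ * L := div_sideLength_sq hρ hN0
  have hNρL : (N : ℝ) = ρ * L ^ 3 := by
    have h3 := sideLength_pow_three hρ N
    rw [← hLdef] at h3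
    rw [h3]; field_simp
  have herr : ENNReal.ofReal θ * (ENNReal.ofReal T *
      ((N : ℝ≥0∞) + (ENNReal.ofReal c)⁻¹ * (E' + θ₀))) ≤ θ₀ := by
    -- bound `E' ≤ CN`, convert to reals
    have h1 : ENNReal.ofReal θ * (ENNReal.ofReal T * ((N : ℝ≥0∞) + (ENNReal.ofReal c)⁻¹ * (E' + θ₀)))
        ≤ ENNReal.ofReal (θ * (T * (N + c⁻¹ * (C * N + ε * N / (2 * L ^ 2))))) := by
      have hc' : (ENNReal.ofReal c)⁻¹ = ENNReal.ofReal c⁻¹ := (ENNReal.ofReal_inv_of_pos hc).symm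
      rw [hc', hθ₀, ← ENNReal.ofReal_natCast]
      calc ENNReal.ofReal θ * (ENNReal.ofReal T * (ENNReal.ofReal (N : ℝ) +
              ENNReal.ofReal c⁻¹ * (E' + ENNReal.ofReal (ε * N / (2 * L ^ 2)))))
          ≤ ENNReal.ofReal θ * (ENNReal.ofReal T * (ENNReal.ofReal (N : ℝ) +
              ENNReal.ofReal c⁻¹ * (ENNReal.ofReal (C * N) + ENNReal.ofReal (ε * N / (2 * L ^ 2))))) := by
            gcongr
        _ = ENNReal.ofReal (θ * (T * (N + c⁻¹ * (C * N + ε * N / (2 * L ^ 2))))) := by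
            rw [← ENNReal.ofReal_add (by positivity) (by positivity),
              ← ENNReal.ofReal_mul (by positivity), ← ENNReal.ofReal_add (by positivity) (by positivity),
              ← ENNReal.ofReal_mul hT0, ← ENNReal.ofReal_mul hθ0]
    refine h1.trans (ENNReal.ofReal_le_ofReal ?_)
    -- real inequality: `θ T (N + (CN + εN/(2L²))/c) ≤ ε N/(2L²)`
    have h1s : 1 - s⁻¹ ≤ κ / N := by
      -- `1 - 1/s = (κ/N)/s ≤ κ/N` since `s ≥ 1`
      have e : 1 - s⁻¹ = (κ / N) / s := by
        rw [hsdef]; field_simp; ring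
      rw [e]
      exact div_le_self (by positivity) hs1
    have hθle : θ ≤ 2 * K * R * κ / N := by
      rw [hθ]
      calc K * s * R * (1 - s⁻¹) ≤ K * 2 * R * (κ / N) := by
            apply mul_le_mul (mul_le_mul_of_nonneg_right (mul_le_mul_of_nonneg_left hs2 hK) hR.le)
              h1s h1s0 (by positivity)
        _ = 2 * K * R * κ / N := by ring
    have hinner : (N : ℝ) + c⁻¹ * (C * N + ε * N / (2 * L ^ 2)) ≤ N * (1 + (C + ε) / c) := by
      have hL2 : ε * N / (2 * L ^ 2) ≤ ε * N := by
        rw [div_le_iff₀ (by positivity)]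
        have : (1 : ℝ) ≤ 2 * L ^ 2 := by nlinarith
        nlinarith [mul_pos hε hNpos]
      have : c⁻¹ * (C * N + ε * N / (2 * L ^ 2)) ≤ c⁻¹ * (C * N + ε * N) :=
        mul_le_mul_of_nonneg_left (by linarith) (inv_nonneg.2 hc.le)
      rw [show (N : ℝ) * (1 + (C + ε) / c) = N + c⁻¹ * (C * N + ε * N) by ring]
      linarith
    have hZ : θ * (T * (N + c⁻¹ * (C * N + ε * N / (2 * L ^ 2)))) ≤ Z₀ * Real.sqrt (Real.sqrt N) := by
      calc θ * (T * (N + c⁻¹ * (C * N + ε * N / (2 * L ^ 2))))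
          ≤ (2 * K * R * κ / N) * (T * (N * (1 + (C + ε) / c))) := by
            apply mul_le_mul hθle (mul_le_mul_of_nonneg_left hinner hT0) (by positivity) (by positivity)
        _ = Z₀ * Real.sqrt (Real.sqrt N) := by
            rw [hT, hZ₀, hM]; field_simp
    have hfinal : Z₀ * Real.sqrt (Real.sqrt N) ≤ ε / 2 * (ρ * L) := by
      rw [hNρL]
      exact quarter_power_le hZ₀0 hε hρ hLpos.le hLm
    calc θ * (T * (N + c⁻¹ * (C * N + ε * N / (2 * L ^ 2)))) ≤ ε / 2 * (ρ * L) := hZ.trans hfinal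
      _ = ε * N / (2 * L ^ 2) := by rw [← hNL]; field_simp
  -- conclusion: `E₀(v_s) ≤ E' + θ₀ + θ₀ = E' + εN/L²`
  have hθθ : θ₀ + θ₀ = ENNReal.ofReal (ε * N / L ^ 2) := by
    rw [hθ₀, ← ENNReal.ofReal_add (by positivity) (by positivity)]
    congr 1; field_simp; ring
  calc groundStateEnergy (scalePotential s v) N (s * L)
      ≤ E' + θ₀ + θ₀ := hbig.trans (add_le_add le_rfl herr)
    _ = E' + ENNReal.ofReal (ε * N / L ^ 2) := by rw [add_assoc, hθθ]

end SoftCore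

/-- **`RigidMomentumBound` for soft-core Lipschitz potentials.** Let `v = ofReal ∘ f` with `f`
`K`-Lipschitz, `f = 0` on `[R, ∞)` (`R > 0`) and `f ≥ c > 0` on `[0, r₀)` (`r₀ > 0`). Then there is
`ρ₀ > 0` such that for all `0 < ρ < ρ₀` and `ε > 0`, eventually in `N`, some `δ > 0` makes every
`δ`-near-minimiser `Ψ` of the Dirichlet energy of `N` bosons in the box of side `(N/ρ)^{1/3}` satisfy
`∑ₐ ∫|∑ⱼ ∂_{j,a}Ψ|² ≤ ε N²/L²` — the conclusion of the crux
`…Theses.BECTangentRigidity.RigidMomentumBound` for this class of interactions (the crux itself asks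
it for all repulsive finite-range `v`, hard cores included, and stays open). [folklore] -/
theorem rigidMomentumBound_softCore :
    ∀ (f : ℝ → ℝ) (K R c r₀ : ℝ), 0 ≤ K → 0 < R → 0 < c → 0 < r₀ →
      (∀ r r' : ℝ, |f r - f r'| ≤ K * |r - r'|) → (∀ r : ℝ, R ≤ r → f r = 0) →
      (∀ r : ℝ, 0 ≤ r → r < r₀ → c ≤ f r) →
      ∃ ρ₀ : ℝ, 0 < ρ₀ ∧ ∀ ρ : ℝ, 0 < ρ → ρ < ρ₀ → ∀ ε : ℝ, 0 < ε → ∀ᶠ N : ℕ in atTop,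
        ∃ δ : ℝ≥0∞, 0 < δ ∧ ∀ Ψ : TrialState N (sideLength ρ N),
          energy (fun r => ENNReal.ofReal (f r)) Ψ ≤
              groundStateEnergy (fun r => ENNReal.ofReal (f r)) N (sideLength ρ N) + δ →
            ∑ a : Fin 3, ∫⁻ X, (‖fderiv ℝ Ψ.ψ X (fun _ : Fin N => EuclideanSpace.single a (1 : ℝ))‖₊ : ℝ≥0∞) ^ 2
              ≤ ENNReal.ofReal (ε * (N : ℝ) ^ 2 / sideLength ρ N ^ 2) := by
  intro f K R c r₀ hK hR hc hr₀ hlip hzero hcore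
  have hv : IsRepulsiveFiniteRange fun r => ENNReal.ofReal (f r) :=
    SoftCore.isRepulsiveFiniteRange_ofReal hlip hzero
  -- soft core on the possibly smaller radius `r₁ = min r₀ (2R)`
  set r₁ := min r₀ (2 * R) with hr₁
  have hr₁0 : 0 < r₁ := lt_min hr₀ (by linarith)
  have hr₁R : r₁ ≤ 2 * R := min_le_right _ _
  have hcore₁ : ∀ r : ℝ, 0 ≤ r → r < r₁ → c ≤ f r := fun r hr hr' =>
    hcore r hr (hr'.trans_le (min_le_left _ _))
  obtain ⟨ρ₁, hρ₁, hlin⟩ := stub_dirichletEnergyLinear _ hv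
  have hcs := SoftCore.contactSoftness_softCore hK hR hc hr₁0 hr₁R hlip hzero hcore₁ hρ₁ hlin
  have hS4 := stub_displacementSoftness_of_contactSoftness _ ⟨ρ₁, hρ₁, hlin⟩ hcs
  exact stub_rigidMomentumBound_of_displacementSoftness_at _ hv hS4

end Summit.AtomisticToContinuum.BoseEinsteinCondensation.Theorems.RigidMomentumBound

end
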